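import Literature.InformationTheory.Entanglement.SpinSqueezingCriterion
import HarnessLib

/-!
# The optimal spin squeezing inequalities (Tóth–Knapp–Gühne–Briegel 2007, Observation 1 (2c)–(2d);
# Gühne–Tóth (204c)–(204d)) on fully separable `N`-qubit states

Hodge foundations lane (`lit-hodgefound`, prover p24 gen 79; quantum-information series).  THEOREMS ONLY: no
definition, no named fact, net debt 0.  Vocabulary of `SpinSqueezingCriterion.lean` (pub-qadeq): the register
`Fin N → Bool`, `collectiveSpin l N = J_l = ½Σ_i σ_l^{(i)}`, product vectors `productVec φ` with Bloch components
`bloch l (φ i) = ⟨φ_i|σ_l|φ_i⟩`, `vecState ψ A = Re⟨ψ|A|ψ⟩`, `trState ρ A = Re Tr(ρA)`, `variance ψ A`, `varianceT ρ A`,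
fully separable mixed states `IsSeparable ρ`.  That file proves (194) (Sørensen–Duan–Cirac–Zoller), (195) = (2b)
(`singlet_criterion`) and (197) (Dicke); this file adds the two remaining members (2c), (2d) of the complete set.

## Sources, VERBATIM

* G. Tóth, C. Knapp, O. Gühne, H. J. Briegel, *Optimal spin squeezing inequalities detect bound entanglement in spin
  models*, PRL 99 (2007) 250405 [TothKnappGuhneBriegel2007], held `paper:arxiv-quant-ph_0702219` p0002:
  «**Observation 1.** Let us assume that for a physical system the values of `J⃗ := (⟨J_x⟩,⟨J_y⟩,⟨J_z⟩)` and
  `K⃗ := (⟨J_x²⟩,⟨J_y²⟩,⟨J_z²⟩)` are known. Violation of any of the following inequalities implies entanglement: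
  `⟨J_x²⟩ + ⟨J_y²⟩ + ⟨J_z²⟩ ≤ N(N+2)/4`, (2a) `(ΔJ_x)² + (ΔJ_y)² + (ΔJ_z)² ≥ N/2`, (2b)
  `⟨J_i²⟩ + ⟨J_j²⟩ − N/2 ≤ (N−1)(ΔJ_k)²`, (2c) `(N−1)[(ΔJ_i)² + (ΔJ_j)²] ≥ ⟨J_k²⟩ + N(N−2)/4`, (2d) where `i,j,k` take
  all the possible permutations of `x,y,z`. The proof is given in the Appendix.»; p0005: «Appendix — Proof of
  Observation 1. Fully separable states are of the form `ρ = Σ_l p_l ρ_l^{(1)} ⊗ ρ_l^{(2)} ⊗ … ⊗ ρ_l^{(N)}` … The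
  variance … is concave in the state thus it suffices to prove that the inequalities of Observation 1 are satisfied
  by pure product states. Based on the theory of angular momentum, Eq. (2a) is valid for all quantum states. For
  Eq. (2b) one first needs that for product states `(ΔJ_k)² = N/4 − (1/4)Σ_i⟨σ_k^{(i)}⟩²` holds, then the statement
  follows form the normalization of the Bloch vector. Concerning Eq. (2c), we have to show that
  `𝔜 := (N−1)(ΔJ_x)² + N/2 − ⟨J_y²⟩ − ⟨J_z²⟩ ≥ 0`. Using the abbreviation `x_i = ⟨σ_x^{(i)}⟩, y_i = ⟨σ_y^{(i)}⟩`, etc.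
  this can be written as `𝔜 = (N−1)[N/4 − (1/4)Σ_i x_i²] − (1/4)Σ_{i≠j}(y_iy_j + z_iz_j) = (N−1)[N/4 − (1/4)Σ_i x_i²]
  − (1/4)[(Σ_i y_i)² + (Σ_i z_i)²] + (1/4)Σ_i(y_i² + z_i²)`. Using the fact that `(Σ_i s_i)² ≤ NΣ_i s_i²`, and the
  normalization of the Bloch vector, it follows that `𝔜 ≥ 0`. Eq. (2d) can be proved in the same way.»
* O. Gühne, G. Tóth, *Entanglement detection*, Phys. Rep. 474 (2009) 1 [GuhneToth2009], § 8.1.5 eqs. (204a)–(204d)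
  (fetched `paper:arxiv-0811.2803` p0071): «the first and second order moments of collective angular momenta for fully
  separable states fulfill simple constraints, namely [(204a)–(204d) = (2a)–(2d)]. While Eq. (204a) is valid for all
  quantum states, Eqs. (204.b-d) can be violated. Any state violating them is entangled.»
* G. Tóth, I. Apellaniz, J. Phys. A 47 (2014) 424006 [TothApellaniz2014], § 3.3 (held `paper:arxiv-1405.4878` p0009):
  the same four inequalities «For separable states … where `k,l,m` take all the possible permutations of `x,y,z`».

## What is formalized (all PROVED); `(k, l, m)` ranges over the permutations of `(x, y, z)` via
`[k, l, m] ~ [X, Y, Z]` (`List.Perm`, decidable: supply `by decide`)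

* `bloch_sq_sum_perm` (`k_i² + l_i² + m_i² = 1` for a unit qubit vector, any permutation), the Cauchy–Schwarz step
  «`(Σ_i s_i)² ≤ NΣ_i s_i²`» is Mathlib's `sq_sum_le_card_mul_sum_sq`.
* pure product states (the Appendix computation): **`ineq_c_productVec`** (`⟨J_k²⟩ + ⟨J_l²⟩ − N/2 ≤ (N−1)(ΔJ_m)²`) and
  **`ineq_d_productVec`** (`(N−1)[(ΔJ_k)² + (ΔJ_l)²] ≥ ⟨J_m²⟩ + N(N−2)/4`), from
  `SpinSqueezing.expect_collectiveSpin_sq` / `variance_collectiveSpin`.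
* fully separable mixed states («the variance … is concave … it suffices to prove [them] by pure product states»):
  **`ineq_c`** ((2c) = (204c)) and **`ineq_d`** ((2d) = (204d)) for every `IsSeparable ρ`, `N ≥ 1`; violations certify
  entanglement: `not_isSeparable_of_ineq_c_violation`, `not_isSeparable_of_ineq_d_violation`.

NOT formalized: (2a) («valid for all quantum states», angular-momentum theory), the completeness statement
(Observation 2) and the polytope vertices `A_k, B_k`, the bound-entanglement applications (Observations 3–4).
Tree search (FAIL-DUP, 2026-09-01): `rg -il "optimal spin squeezing|250405|042334|Knapp" Literature/InformationTheory`
→ `UnentangledSpinsBound.lean` (cites Tóth–Knapp–Gühne–Briegel only for (196)); (2b) is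
`SpinSqueezing.singlet_criterion` and is not restated.
-/

noncomputable section

open scoped BigOperators ComplexOrder
open Matrix Complex Finset
open Literature.Computability.QuantumComplexity
open Literature.InformationTheory.Entanglement.Tsirelson

namespace Literature.InformationTheory.Entanglement

namespace OptimalSpinSqueezing

open SpinSqueezing MerminKlyshkoGHZ

variable {N : ℕ}

/-! ## The Bloch-vector normalisation for any permutation of the axes, and state-functional plumbing -/

/-- `k_i² + l_i² + m_i² = 1` for a unit qubit vector and `(k, l, m)` any permutation of `(x, y, z)` («the
normalization of the Bloch vector»). [cite: TothKnappGuhneBriegel2007, Appendix] -/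
theorem bloch_sq_sum_perm {k l m : Pauli} (hperm : [k, l, m].Perm [Pauli.X, Pauli.Y, Pauli.Z]) (φ : Bool → ℂ)
    (hφ : star φ ⬝ᵥ φ = 1) : bloch k φ ^ 2 + bloch l φ ^ 2 + bloch m φ ^ 2 = 1 := by
  have h := (hperm.map fun q => bloch q φ ^ 2).sum_eq
  simp only [List.map_cons, List.map_nil, List.sum_cons, List.sum_nil, add_zero] at h
  rw [← add_assoc] at h
  rw [h, ← add_assoc]
  exact bloch_sq_sum φ hφ

/-- `Tr(|ψ⟩⟨ψ| M) = ⟨ψ|M|ψ⟩`. [folklore] -/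
private theorem trState_vecMulVec (ψ : (Fin N → Bool) → ℂ) (M : Matrix (Fin N → Bool) (Fin N → Bool) ℂ) :
    trState (vecMulVec ψ (star ψ)) M = vecState ψ M := by
  rw [trState_apply, vecState_apply, Matrix.trace_mul_comm, Matrix.mul_vecMulVec, Matrix.trace_vecMulVec,
    dotProduct_comm]

/-- `Tr((Σ p_k |ψ_k⟩⟨ψ_k|) M) = Σ p_k ⟨ψ_k|M|ψ_k⟩`. [folklore] -/
private theorem trState_mixture {ι : Type*} [Fintype ι] (p : ι → ℝ) (ψ : ι → (Fin N → Bool) → ℂ)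
    (M : Matrix (Fin N → Bool) (Fin N → Bool) ℂ) :
    trState (∑ k, (p k : ℂ) • vecMulVec (ψ k) (star (ψ k))) M = ∑ k, p k * vecState (ψ k) M := by
  rw [trState_apply, Finset.sum_mul, Matrix.trace_sum, Complex.re_sum]
  refine Finset.sum_congr rfl fun k _ => ?_
  rw [Matrix.smul_mul, Matrix.trace_smul, smul_eq_mul, Complex.re_ofReal_mul, ← trState_apply, trState_vecMulVec]

/-! ## Pure product states: the Appendix computation -/

section ProductState

variable {k l m : Pauli}

/-- `Σ_i k_i² + Σ_i l_i² + Σ_i m_i² = N` in a product state of unit qubits. [cite: TothKnappGuhneBriegel2007, Appendix] -/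
theorem sum_bloch_sq_add (hperm : [k, l, m].Perm [Pauli.X, Pauli.Y, Pauli.Z]) (φ : Fin N → Bool → ℂ)
    (hφ : ∀ i, star (φ i) ⬝ᵥ φ i = 1) :
    ∑ i, bloch k (φ i) ^ 2 + ∑ i, bloch l (φ i) ^ 2 + ∑ i, bloch m (φ i) ^ 2 = N := by
  rw [← Finset.sum_add_distrib, ← Finset.sum_add_distrib]
  simp_rw [bloch_sq_sum_perm hperm _ (hφ _)]
  simp

/-- **(2c) for pure product states** («`𝔜 := (N−1)(ΔJ_x)² + N/2 − ⟨J_y²⟩ − ⟨J_z²⟩ ≥ 0` … Using the fact that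
`(Σ_i s_i)² ≤ NΣ_i s_i²`, and the normalization of the Bloch vector»), for any permutation `(k, l, m)` of the axes:
`⟨J_k²⟩ + ⟨J_l²⟩ − N/2 ≤ (N − 1)(ΔJ_m)²`. [cite: TothKnappGuhneBriegel2007, Observation 1 (2c) and Appendix] -/
theorem ineq_c_productVec (hperm : [k, l, m].Perm [Pauli.X, Pauli.Y, Pauli.Z]) (φ : Fin N → Bool → ℂ)
    (hφ : ∀ i, star (φ i) ⬝ᵥ φ i = 1) :
    vecState (productVec φ) (collectiveSpin k N * collectiveSpin k N) +
        vecState (productVec φ) (collectiveSpin l N * collectiveSpin l N) - N / 2 ≤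
      (N - 1) * variance (productVec φ) (collectiveSpin m N) := by
  rw [expect_collectiveSpin_sq φ hφ, expect_collectiveSpin_sq φ hφ, variance_collectiveSpin φ hφ]
  have hB := sum_bloch_sq_add hperm φ hφ
  have csk := sq_sum_le_card_mul_sum_sq (s := Finset.univ) (f := fun i => bloch k (φ i))
  have csl := sq_sum_le_card_mul_sum_sq (s := Finset.univ) (f := fun i => bloch l (φ i))
  rw [Finset.card_univ, Fintype.card_fin] at csk csl
  have hm : ∑ i, (1 - bloch m (φ i) ^ 2) = N - ∑ i, bloch m (φ i) ^ 2 := by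
    rw [Finset.sum_sub_distrib]; simp
  rw [hm]
  have hN : (0 : ℝ) ≤ N := Nat.cast_nonneg N
  nlinarith [csk, csl, hB, Finset.sum_nonneg fun i (_ : i ∈ univ) => sq_nonneg (bloch k (φ i)),
    Finset.sum_nonneg fun i (_ : i ∈ univ) => sq_nonneg (bloch l (φ i))]

/-- **(2d) for pure product states** («Eq. (2d) can be proved in the same way»): for any permutation `(k, l, m)` of the
axes, `(N − 1)[(ΔJ_k)² + (ΔJ_l)²] ≥ ⟨J_m²⟩ + N(N − 2)/4`. [cite: TothKnappGuhneBriegel2007, Observation 1 (2d) and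
Appendix] -/
theorem ineq_d_productVec (hperm : [k, l, m].Perm [Pauli.X, Pauli.Y, Pauli.Z]) (φ : Fin N → Bool → ℂ)
    (hφ : ∀ i, star (φ i) ⬝ᵥ φ i = 1) :
    vecState (productVec φ) (collectiveSpin m N * collectiveSpin m N) + N * (N - 2) / 4 ≤
      (N - 1) * (variance (productVec φ) (collectiveSpin k N) + variance (productVec φ) (collectiveSpin l N)) := by
  rw [expect_collectiveSpin_sq φ hφ, variance_collectiveSpin φ hφ, variance_collectiveSpin φ hφ]
  have hB := sum_bloch_sq_add hperm φ hφ
  have csm := sq_sum_le_card_mul_sum_sq (s := Finset.univ) (f := fun i => bloch m (φ i))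
  rw [Finset.card_univ, Fintype.card_fin] at csm
  have hk : ∑ i, (1 - bloch k (φ i) ^ 2) = N - ∑ i, bloch k (φ i) ^ 2 := by
    rw [Finset.sum_sub_distrib]; simp
  have hl : ∑ i, (1 - bloch l (φ i) ^ 2) = N - ∑ i, bloch l (φ i) ^ 2 := by
    rw [Finset.sum_sub_distrib]; simp
  rw [hk, hl]
  nlinarith [csm, hB]

end ProductState

/-! ## Fully separable mixed states: Observation 1 (2c), (2d) -/

/-- **Observation 1 (2c) = Gühne–Tóth (204c)**: for every fully separable `N`-qubit state (`N ≥ 1`) and every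
permutation `(k, l, m)` of the axes, `⟨J_k²⟩ + ⟨J_l²⟩ − N/2 ≤ (N − 1)(ΔJ_m)²`.  Road as printed: the variance is
concave in the state (`SpinSqueezing.varianceT_mixture_ge`), the left-hand side is linear, so the pure-product bound
suffices. [cite: TothKnappGuhneBriegel2007, Observation 1 (2c)] [cite: GuhneToth2009, §8.1.5 eq. (204c)]
[cite: TothApellaniz2014, §3.3] -/
theorem ineq_c {k l m : Pauli} (hperm : [k, l, m].Perm [Pauli.X, Pauli.Y, Pauli.Z]) (hN : 1 ≤ N)
    {ρ : Matrix (Fin N → Bool) (Fin N → Bool) ℂ} (hρ : IsSeparable ρ) :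
    trState ρ (collectiveSpin k N * collectiveSpin k N) + trState ρ (collectiveSpin l N * collectiveSpin l N) - N / 2 ≤
      (N - 1) * varianceT ρ (collectiveSpin m N) := by
  obtain ⟨ι, _, p, ψ, hp, h1, hψ, rfl⟩ := hρ
  have hN1 : (0 : ℝ) ≤ N - 1 := by
    have : (1 : ℝ) ≤ N := by exact_mod_cast hN
    linarith
  have hvar := varianceT_mixture_ge p hp h1 ψ (collectiveSpin m N)
  rw [trState_mixture, trState_mixture]
  -- termwise product bound, weighted by `p_k`
  have hk : ∀ j, p j * vecState (ψ j) (collectiveSpin k N * collectiveSpin k N) +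
      p j * vecState (ψ j) (collectiveSpin l N * collectiveSpin l N) - p j * (N / 2) ≤
      p j * ((N - 1) * variance (ψ j) (collectiveSpin m N)) := by
    intro j
    obtain ⟨φ, hφ, hj⟩ := hψ j
    rw [← mul_add, ← mul_sub, hj]
    exact mul_le_mul_of_nonneg_left (ineq_c_productVec hperm φ hφ) (hp j)
  have hsum := Finset.sum_le_sum fun j (_ : j ∈ univ) => hk j
  rw [Finset.sum_sub_distrib, Finset.sum_add_distrib, ← Finset.sum_mul, h1, one_mul] at hsum
  have hrhs : ∑ j, p j * ((N - 1) * variance (ψ j) (collectiveSpin m N)) =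
      (N - 1) * ∑ j, p j * variance (ψ j) (collectiveSpin m N) := by
    rw [Finset.mul_sum]; exact Finset.sum_congr rfl fun j _ => by ring
  rw [hrhs] at hsum
  exact hsum.trans (mul_le_mul_of_nonneg_left hvar hN1)

/-- **Observation 1 (2d) = Gühne–Tóth (204d)**: for every fully separable `N`-qubit state (`N ≥ 1`) and every
permutation `(k, l, m)` of the axes, `(N − 1)[(ΔJ_k)² + (ΔJ_l)²] ≥ ⟨J_m²⟩ + N(N − 2)/4`.
[cite: TothKnappGuhneBriegel2007, Observation 1 (2d)] [cite: GuhneToth2009, §8.1.5 eq. (204d)]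
[cite: TothApellaniz2014, §3.3] -/
theorem ineq_d {k l m : Pauli} (hperm : [k, l, m].Perm [Pauli.X, Pauli.Y, Pauli.Z]) (hN : 1 ≤ N)
    {ρ : Matrix (Fin N → Bool) (Fin N → Bool) ℂ} (hρ : IsSeparable ρ) :
    trState ρ (collectiveSpin m N * collectiveSpin m N) + N * (N - 2) / 4 ≤
      (N - 1) * (varianceT ρ (collectiveSpin k N) + varianceT ρ (collectiveSpin l N)) := by
  obtain ⟨ι, _, p, ψ, hp, h1, hψ, rfl⟩ := hρ
  have hN1 : (0 : ℝ) ≤ N - 1 := by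
    have : (1 : ℝ) ≤ N := by exact_mod_cast hN
    linarith
  have hvk := varianceT_mixture_ge p hp h1 ψ (collectiveSpin k N)
  have hvl := varianceT_mixture_ge p hp h1 ψ (collectiveSpin l N)
  rw [trState_mixture]
  have hk : ∀ j, p j * vecState (ψ j) (collectiveSpin m N * collectiveSpin m N) + p j * (N * (N - 2) / 4) ≤
      p j * ((N - 1) * (variance (ψ j) (collectiveSpin k N) + variance (ψ j) (collectiveSpin l N))) := by
    intro j
    obtain ⟨φ, hφ, hj⟩ := hψ j
    rw [← mul_add, hj]
    exact mul_le_mul_of_nonneg_left (ineq_d_productVec hperm φ hφ) (hp j)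
  have hsum := Finset.sum_le_sum fun j (_ : j ∈ univ) => hk j
  rw [Finset.sum_add_distrib, ← Finset.sum_mul, h1, one_mul] at hsum
  have hrhs : ∑ j, p j * ((N - 1) * (variance (ψ j) (collectiveSpin k N) + variance (ψ j) (collectiveSpin l N))) =
      (N - 1) * (∑ j, p j * variance (ψ j) (collectiveSpin k N) + ∑ j, p j * variance (ψ j) (collectiveSpin l N)) := by
    rw [← Finset.sum_add_distrib, Finset.mul_sum]; exact Finset.sum_congr rfl fun j _ => by ring
  rw [hrhs] at hsum
  exact hsum.trans (mul_le_mul_of_nonneg_left (add_le_add hvk hvl) hN1)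

/-- **Violation of (2c) certifies entanglement** («Violation of any of the following inequalities implies
entanglement»). [cite: TothKnappGuhneBriegel2007, Observation 1] [cite: GuhneToth2009, §8.1.5 («Any state violating
them is entangled»)] -/
theorem not_isSeparable_of_ineq_c_violation {k l m : Pauli} (hperm : [k, l, m].Perm [Pauli.X, Pauli.Y, Pauli.Z])
    (hN : 1 ≤ N) {ρ : Matrix (Fin N → Bool) (Fin N → Bool) ℂ}
    (h : (N - 1) * varianceT ρ (collectiveSpin m N) <
      trState ρ (collectiveSpin k N * collectiveSpin k N) + trState ρ (collectiveSpin l N * collectiveSpin l N) - N / 2) :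
    ¬ IsSeparable ρ :=
  fun hρ => absurd h (not_lt.2 (ineq_c hperm hN hρ))

/-- **Violation of (2d) certifies entanglement.** [cite: TothKnappGuhneBriegel2007, Observation 1]
[cite: GuhneToth2009, §8.1.5] -/
theorem not_isSeparable_of_ineq_d_violation {k l m : Pauli} (hperm : [k, l, m].Perm [Pauli.X, Pauli.Y, Pauli.Z])
    (hN : 1 ≤ N) {ρ : Matrix (Fin N → Bool) (Fin N → Bool) ℂ}
    (h : (N - 1) * (varianceT ρ (collectiveSpin k N) + varianceT ρ (collectiveSpin l N)) <
      trState ρ (collectiveSpin m N * collectiveSpin m N) + N * (N - 2) / 4) :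
    ¬ IsSeparable ρ :=
  fun hρ => absurd h (not_lt.2 (ineq_d hperm hN hρ))

/-- The three named instances of (2c) («`i,j,k` take all the possible permutations of `x,y,z`»; the left-hand side is
symmetric in `i, j`): `m = z`, `m = y`, `m = x`. [cite: TothKnappGuhneBriegel2007, Observation 1 (2c)] -/
theorem ineq_c_xyz (hN : 1 ≤ N) {ρ : Matrix (Fin N → Bool) (Fin N → Bool) ℂ} (hρ : IsSeparable ρ) :
    (trState ρ (collectiveSpin Pauli.X N * collectiveSpin Pauli.X N) +
        trState ρ (collectiveSpin Pauli.Y N * collectiveSpin Pauli.Y N) - N / 2 ≤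
      (N - 1) * varianceT ρ (collectiveSpin Pauli.Z N)) ∧
    (trState ρ (collectiveSpin Pauli.X N * collectiveSpin Pauli.X N) +
        trState ρ (collectiveSpin Pauli.Z N * collectiveSpin Pauli.Z N) - N / 2 ≤
      (N - 1) * varianceT ρ (collectiveSpin Pauli.Y N)) ∧
    (trState ρ (collectiveSpin Pauli.Y N * collectiveSpin Pauli.Y N) +
        trState ρ (collectiveSpin Pauli.Z N * collectiveSpin Pauli.Z N) - N / 2 ≤
      (N - 1) * varianceT ρ (collectiveSpin Pauli.X N)) :=
  ⟨ineq_c (k := Pauli.X) (l := Pauli.Y) (m := Pauli.Z) (by decide) hN hρ,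
    ineq_c (k := Pauli.X) (l := Pauli.Z) (m := Pauli.Y) (by decide) hN hρ,
    ineq_c (k := Pauli.Y) (l := Pauli.Z) (m := Pauli.X) (by decide) hN hρ⟩

end OptimalSpinSqueezing

end Literature.InformationTheory.Entanglement
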